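import Summits.MatrixMultiplication.OmegaCensus.DominoZ7Z7Cells
import Summits.MatrixMultiplication.OmegaCensus.DominoNormCongruenceTPP
import Summits.MatrixMultiplication.OmegaCensus.CubeLawNoCosetPartThreeSix
import Summits.MatrixMultiplication.OmegaCensus.ThreeSetZ4Z4Cells
import Summits.MatrixMultiplication.OmegaCensus.DihedralLawModOneOrder25
import Summits.MatrixMultiplication.OmegaCensus.DihedralLawModOneOrder784Arith
import HarnessLib

/-!
# The `|A| ≡ 1 (mod 3)` law at `|A| = 784` over `A ↠ ℤ_7 × ℤ_7`: one kernel theorem per group (order 784 fully kernel)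

ω-census `pub-omega`, family (b3), seat pub-omega-group gen 39.  Framing: lottery ticket; floor = certified bounds/negative ranges.
VALUE: the census line `|A| = 784` of the classification of dihedral-like groups attaining `3|S||T||U| + 8 = 8|A|`
('law ⟹ an element of order `≥ |A|/2`') as ONE kernel theorem, assembled from existing kernel results — the domino cell
`(1,3,87)` (`no_law_cube_13e_of_onto_z7z7`, gen 20), the domino cell `(1,9,29)` by the NORM CONGRUENCE
(`no_law_cube_1d_of_onto_zpzp`, gen 30: `7² ∤ (3·9²)⁶ − 1`; this cell was listed 'engine-only' in the gen-38 coverage table), the coset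
part `3` of `(3,3,29)` by the Conway–Lagarias / sheared-torus bound (`cube_law_no_coset_part_three_six`, gen 35) with the exponent
bound `addOrderOf ≤ 112` DERIVED from `|A| = 784 = 16 · 49` and `A ↠ ℤ_7²` (`addOrderOf_le_of_onto_card`), and the structure theorems
(non-cube / two parts `1` ⇒ an element of order `≥ |A|/2`); no new computation; NOT progress on ω.
Instances (`DihedralLawModOneOrder784Instances.lean`): `ℤ₇ × ℤ₁₁₂`, `ℤ₁₄ × ℤ₅₆`, `ℤ₂₈ × ℤ₂₈` — every abelian group of order `784` of `2`-rank `≤ 2`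
without an element of order `≥ 392`, except `ℤ₄ × ℤ₁₉₆` (covered by the `ℤ₄²` theorems, `ThreeSetZ4Z4Cells`).
-/

namespace Summit.MatrixMultiplication.OmegaCensus

open Literature.Combinatorics.Additive Finset

section Kernel

variable {A : Type*} [AddCommGroup A] [Finite A]

/-- **Exponent from a quotient.** If the finite abelian group `A` maps onto `B` with `|A| = k · |B|` and `n • b = 0` on `B`,
then every element of `A` has order `≤ k · n`: `n • x` lies in the kernel, which has `k` elements. [folklore] -/
theorem addOrderOf_le_of_onto_card {B : Type*} [AddCommGroup B] {k n : ℕ} (Φ : A →+ B) (hΦ : Function.Surjective Φ)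
    (hcard : Nat.card A = k * Nat.card B) (hn : ∀ b : B, n • b = 0) (hk : 0 < k) (hn0 : 0 < n) (x : A) :
    addOrderOf x ≤ k * n := by
  have hker : Nat.card Φ.ker = k := by
    have h1 := AddSubgroup.card_eq_card_quotient_mul_card_addSubgroup Φ.ker
    have h2 : Nat.card (A ⧸ Φ.ker) = Nat.card B := Nat.card_congr (QuotientAddGroup.quotientKerEquivOfSurjective Φ hΦ).toEquiv
    rw [h2, hcard, mul_comm k] at h1
    have hB : 0 < Nat.card B := Nat.card_pos_iff.2 ⟨⟨0⟩, Finite.of_surjective Φ hΦ⟩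
    exact (Nat.eq_of_mul_eq_mul_left hB h1).symm
  have hmem : n • x ∈ Φ.ker := by rw [AddMonoidHom.mem_ker, map_nsmul, hn]
  have hdvd : addOrderOf (n • x) ∣ k := hker ▸ AddSubgroup.addOrderOf_dvd_natCard Φ.ker hmem
  have hkn : (k * n) • x = 0 := by
    rw [mul_comm, mul_nsmul]
    exact addOrderOf_dvd_iff_nsmul_eq_zero.1 hdvd
  exact Nat.le_of_dvd (Nat.mul_pos hk hn0) (addOrderOf_dvd_of_nsmul_eq_zero hkn)

end Kernel

section DihedralLike

variable {A : Type} [AddCommGroup A] [DecidableEq A] [Fintype A] {G : Type} [Group G] [DecidableEq G]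
  {ρ τ : A → G} {c₀ : A} {S T U : Finset G}

/-- **No law over `A` of order `784` with all element orders `< |A|/2` and `A ↠ ℤ_7²** (any presentation constant `c₀`):
cube shapes `stu = 261` — `(1,1,261)`, `(1,3,87)`, `(1,9,29)`, `(3,3,29)`: two parts `1`, the cell `(1,3,87)` (`no_law_cube_13e_of_onto_z7z7`), the cell `(1,9,29)` by the domino norm congruence (`no_law_cube_1d_of_onto_zpzp`: `49 ∤ 243⁶ − 1`), and a coset part `3` by the Conway–Lagarias bound (`cube_law_no_coset_part_three_six` with exponent `≤ 112 = 16·7`, derived from `A ↠ ℤ_7²`). [folklore] -/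
theorem no_mod_one_law_card_784_of_onto_z7z7 (hA : Fintype.card A = 784) (hord : ∀ g : A, 2 * addOrderOf g < Fintype.card A)
    (hρρ : ∀ a b, ρ a * ρ b = ρ (a + b)) (hρτ : ∀ a b, ρ a * τ b = τ (b - a))
    (hτρ : ∀ a b, τ a * ρ b = τ (a + b)) (hττ : ∀ a b, τ a * τ b = ρ (c₀ + b - a))
    (hρ : Function.Injective ρ) (hτ : Function.Injective τ) (hne : ∀ a b, ρ a ≠ τ b)
    (hsurj : ∀ g, (∃ a, ρ a = g) ∨ (∃ a, τ a = g))
    (Φ : A →+ ZMod 7 × ZMod 7) (hΦ : Function.Surjective Φ) (h : TripleProductProperty S T U) :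
    3 * (S.card * T.card * U.card) + 8 ≠ 8 * Fintype.card A := by
  haveI : Fact (Nat.Prime 7) := ⟨by norm_num⟩
  intro hV
  have big : ¬ ∃ g : A, Fintype.card A ≤ 2 * addOrderOf g := by
    rintro ⟨g, hg⟩; exact absurd (hord g) (not_lt.2 hg)
  have hmod : Fintype.card A % 3 = 1 := by rw [hA]
  have hA14 : 14 ≤ Fintype.card A := by rw [hA]; norm_num
  have hA7 : 7 ≤ Fintype.card A := by omega
  have hV_TUS : 3 * (T.card * U.card * S.card) + 8 = 8 * Fintype.card A := by
    rw [show T.card * U.card * S.card = S.card * T.card * U.card by ring]; exact hV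
  have hV_UST : 3 * (U.card * S.card * T.card) + 8 = 8 * Fintype.card A := by
    rw [show U.card * S.card * T.card = S.card * T.card * U.card by ring]; exact hV
  have hTUS : TripleProductProperty T U S := h.rotate
  have hUST : TripleProductProperty U S T := h.rotate.rotate
  by_cases hnc : ((univ.filter fun a : A => ρ a ∈ S).card = (univ.filter fun a : A => τ a ∈ S).card ∧
      (univ.filter fun a : A => ρ a ∈ T).card = (univ.filter fun a : A => τ a ∈ T).card ∧
      (univ.filter fun a : A => ρ a ∈ U).card = (univ.filter fun a : A => τ a ∈ U).card)
  · obtain ⟨hS', hT', hU'⟩ := hnc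
    have hexp : ∀ x : A, addOrderOf x ≤ 112 :=
      addOrderOf_le_of_onto_card (k := 16) (n := 7) Φ hΦ
        (by rw [Nat.card_eq_fintype_card, hA, Nat.card_prod, Nat.card_zmod])
        (fun q => by
          refine Prod.ext ?_ ?_
          · show 7 • q.1 = 0
            rw [nsmul_eq_mul, ZMod.natCast_self, zero_mul]
          · show 7 • q.2 = 0
            rw [nsmul_eq_mul, ZMod.natCast_self, zero_mul])
        (by norm_num) (by norm_num)
    obtain ⟨h3S, h3T, h3U⟩ := cube_law_no_coset_part_three_six hρρ hρτ hτρ hττ hρ hτ hne hsurj h hS' hT' hU' hV 112 hexp (by rw [hA]; norm_num)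
    have cS := card_eq_parts' hρ hτ hne hsurj S
    have cT := card_eq_parts' hρ hτ hne hsurj T
    have cU := card_eq_parts' hρ hτ hne hsurj U
    set s₀ := (univ.filter fun a : A => ρ a ∈ S).card with hs₀
    set t₀ := (univ.filter fun a : A => ρ a ∈ T).card with ht₀
    set u₀ := (univ.filter fun a : A => ρ a ∈ U).card with hu₀
    have eS : S.card = 2 * s₀ := by rw [cS, ← hS']; ring
    have eT : T.card = 2 * t₀ := by rw [cT, ← hT']; ring
    have eU : U.card = 2 * u₀ := by rw [cU, ← hU']; ring
    have hprod : 3 * (s₀ * t₀ * u₀) + 1 = 784 := by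
      rw [eS, eT, eU, hA] at hV; nlinarith
    rcases cube_factor_of_784_ordered hprod with ⟨h1, h2, h3⟩ | ⟨h1, h2, h3⟩ | ⟨h1, h2, h3⟩ | ⟨h1, h2, h3⟩ | ⟨h1, h2, h3⟩ | ⟨h1, h2, h3⟩ | ⟨h1, h2, h3⟩ | ⟨h1, h2, h3⟩ | ⟨h1, h2, h3⟩ | ⟨h1, h2, h3⟩ | ⟨h1, h2, h3⟩ | ⟨h1, h2, h3⟩ | ⟨h1, h2, h3⟩ | ⟨h1, h2, h3⟩ | ⟨h1, h2, h3⟩ | ⟨h1, h2, h3⟩ | ⟨h1, h2, h3⟩ | ⟨h1, h2, h3⟩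
    · -- (1,1,261)
      exact big (card_le_two_mul_addOrderOf_of_two_two_law hρρ hρτ hτρ hττ hρ hτ hne hsurj hmod hA7 h (by rw [eS, h1]) (by rw [eT, h2]) hV)
    · -- (1,3,87)
      exact h3T h2
    · -- (1,9,29)
      exact absurd hV (no_law_cube_two_parts_of_ordered 1 9 (fun h' hS₀ hS₁ hT₀ hT₁ hU'' hV'' => no_law_cube_1d_of_onto_zpzp hρρ hρτ hτρ hττ hρ hτ hne hsurj Φ hΦ (by norm_num) (by decide) h' hS₀ hS₁ hT₀ hT₁ hU'' hV'') h hS' hT' hU'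
        (Or.inl ⟨h1, h2⟩))
    · -- (1,29,9)
      exact absurd hV (no_law_cube_two_parts_of_ordered 1 9 (fun h' hS₀ hS₁ hT₀ hT₁ hU'' hV'' => no_law_cube_1d_of_onto_zpzp hρρ hρτ hτρ hττ hρ hτ hne hsurj Φ hΦ (by norm_num) (by decide) h' hS₀ hS₁ hT₀ hT₁ hU'' hV'') h hS' hT' hU'
        (Or.inr (Or.inr (Or.inr (Or.inr (Or.inr (⟨h3, h1⟩)))))))
    · -- (1,87,3)
      exact h3U h3
    · -- (1,261,1)
      exact big (card_le_two_mul_addOrderOf_of_two_two_law hρρ hρτ hτρ hττ hρ hτ hne hsurj hmod hA7 hUST (by rw [eU, h3]) (by rw [eS, h1]) hV_UST)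
    · -- (3,1,87)
      exact h3S h1
    · -- (3,3,29)
      exact h3S h1
    · -- (3,29,3)
      exact h3S h1
    · -- (3,87,1)
      exact h3S h1
    · -- (9,1,29)
      exact absurd hV (no_law_cube_two_parts_of_ordered 1 9 (fun h' hS₀ hS₁ hT₀ hT₁ hU'' hV'' => no_law_cube_1d_of_onto_zpzp hρρ hρτ hτρ hττ hρ hτ hne hsurj Φ hΦ (by norm_num) (by decide) h' hS₀ hS₁ hT₀ hT₁ hU'' hV'') h hS' hT' hU'
        (Or.inr (Or.inr (Or.inr (Or.inl ⟨h1, h2⟩)))))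
    · -- (9,29,1)
      exact absurd hV (no_law_cube_two_parts_of_ordered 1 9 (fun h' hS₀ hS₁ hT₀ hT₁ hU'' hV'' => no_law_cube_1d_of_onto_zpzp hρρ hρτ hτρ hττ hρ hτ hne hsurj Φ hΦ (by norm_num) (by decide) h' hS₀ hS₁ hT₀ hT₁ hU'' hV'') h hS' hT' hU'
        (Or.inr (Or.inr (Or.inl ⟨h3, h1⟩))))
    · -- (29,1,9)
      exact absurd hV (no_law_cube_two_parts_of_ordered 1 9 (fun h' hS₀ hS₁ hT₀ hT₁ hU'' hV'' => no_law_cube_1d_of_onto_zpzp hρρ hρτ hτρ hττ hρ hτ hne hsurj Φ hΦ (by norm_num) (by decide) h' hS₀ hS₁ hT₀ hT₁ hU'' hV'') h hS' hT' hU'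
        (Or.inr (Or.inl ⟨h2, h3⟩)))
    · -- (29,3,3)
      exact h3T h2
    · -- (29,9,1)
      exact absurd hV (no_law_cube_two_parts_of_ordered 1 9 (fun h' hS₀ hS₁ hT₀ hT₁ hU'' hV'' => no_law_cube_1d_of_onto_zpzp hρρ hρτ hτρ hττ hρ hτ hne hsurj Φ hΦ (by norm_num) (by decide) h' hS₀ hS₁ hT₀ hT₁ hU'' hV'') h hS' hT' hU'
        (Or.inr (Or.inr (Or.inr (Or.inr (Or.inl ⟨h2, h3⟩))))))
    · -- (87,1,3)
      exact h3U h3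
    · -- (87,3,1)
      exact h3T h2
    · -- (261,1,1)
      exact big (card_le_two_mul_addOrderOf_of_two_two_law hρρ hρτ hτρ hττ hρ hτ hne hsurj hmod hA7 hTUS (by rw [eT, h2]) (by rw [eU, h3]) hV_TUS)
  · obtain ⟨g, a, b, hab⟩ :=
      two_cosets_of_mod_one_law_of_not_cube hρρ hρτ hτρ hττ hρ hτ hne hsurj hmod hA14 h hV hnc
    exact big ⟨g, card_le_two_mul_addOrderOf_of_two_cosets hab⟩

end DihedralLike

end Summit.MatrixMultiplication.OmegaCensus
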